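import Summits.QuantumFields.QCD.Theses.PauliWegnerSea
import Summits.QuantumFields.QCD.Theorems.TiltedFlatness.Negative.TwoWellFloor
import Summits.QuantumFields.QCD.Theorems.TiltedFlatness.Negative.MasslessKernel
import Literature.MathematicalPhysics.QuantumFieldTheory.StrongCouplingActivities

/-!
# Line `euler-torus-cover` — skeleton for the crux `TiltedFlatness` (stmt-QuantumFields-14070)

Crux (FIXED, by name): `Summit.QuantumFields.QCD.Theses.PauliWegnerSea.TiltedFlatness` (rev 4 = C′:
(a) `F(W₀) ≤ C(1+β)^p M_β`, (b′) `ν_β(F ≤ εM_β) ≤ C(1+β)^p ε^c` on the two-star fibre, constants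
depending on `N_f` only).  Route `route-QuantumFields-PauliWegnerSea` (rank 3).

LINE (crux-plan, idea `Ideas/euler-torus-cover.md`, ideator 2, triage r1-1/2/3: pass ×3).
LEVER: the exact, Jacobian-free coupling `Haar^{⊗n} = Haar^{⊗n} ∗ Φ_*Leb(T^m)` for a word `Φ` in
CLOSED one-parameter subgroups of `SU(3)` that is ONTO each link (`wordCoupling`, PROVED below, and
`stub_eulerWord`).  Along every fibre `t ↦ g·Φ(t)` the sea `det diracMatrix (refit ·) mq` is a
trigonometric polynomial of `L`-, outside-, mass-independent multidegree (band limit = the route's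
thesis), and every fibre passes through every point of `SU(3)^n` — so relative small balls under
product Haar are an AVERAGE of relative small balls of trigonometric polynomials on the FLAT torus
(`stub_wordPullback`), which the β = 0 Carbery–Wright / Remez engine decides (`stub_torusSmallBalls`,
the Transfer `C⁺`, now split from the tilt as triage r1-1 asked); the tilt is paid ONCE, ball-free, by
the Lebesgue cube of side `1/(βKm)` at the fibre's own action minimiser (`stub_cubeUntilt`); and the
kernel-checked trunk `R1DensityReduction.tiltedFlatness_of_R1_density :
HaarRelativeSmallBalls → TiltDensityBound → TiltedFlatness` (ideator 3, rc 0, standard axioms;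
here `cruxOfR1Density_holds`, §0) assembles the crux.  `TiltedFlatness_of` composes the five stubs
into the crux BY NAME.

Stubs (5, registered): `stub_eulerWord` (M) · `stub_torusSmallBalls` (L, hardest) ·
`stub_wordPullback` (M) · `stub_seaPolynomial` (M) · `stub_cubeUntilt` (M).
Shared vocabulary — VERBATIM COPIES (§0) of `Lines/R1DensityReduction.lean`'s `SU3SurjectiveWord`,
`HaarRelativeSmallBalls`, `TiltDensityBound`, `flatness_and_smallBalls_of_anticoncentration`,
`tiltedFlatness_of_R1_density` (that module is not yet built on the farm, so it cannot be imported
today; the bodies are byte-identical, `Iff.rfl` identifies them, and the stubs `stub_eulerWord`,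
`stub_seaPolynomial`'s target and `stub_cubeUntilt`'s target are therefore literally shared with
line torus-word-abelianisation).

Disproof.lean honoured (cdisprove, read 2026-08-16T02Z; it has NO `_false_without_<H>` theorem for
14070): the `(1+β)^p` loss is necessary in BOTH clauses (`not_flatnessClauseUniform`,
`twinWell_refutes_smallBallClause`) — here the only β-dependence is `stub_cubeUntilt`'s
`(1+β)^m`, `m` = number of angles, never claimed uniform; constants must depend on `N_f`
(`not_tiltedFlatnessUniformInNf`) — they do, through the degree `D(N_f)` of `stub_seaPolynomial`;
`KerWilsonDiracMassless` / `FreeStarFibre` structural zeros (`F ≡ 0` on an 8-dimensional orbit) are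
consistent with every stub (all small-ball statements are relative to a NON-ZERO reference value and
polynomial zero sets are null).  Landed Negative lemmas imported for the scratch check:
`Negative.TwoWellFloor` (`small_ball_floor`), `Negative.MasslessKernel`
(`det_wilsonDirac_massless_eq_zero_iff`); `Negative.FreeStarFibre` (p74106) is accepted but not yet
built on the farm — read at source; none is an instance of a stub.  Negatives index
(`ledger negatives`: stmt-9665/9603/9494/9599 — MultibosonBridge ×2, AdaptiveBlockFermions,
MirrorModularBoosts; all unrelated): untouched.
-/

namespace Summit.QuantumFields.QCD.Cruxes.TiltedFlatness.EulerTorusCover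

open scoped BigOperators Real ENNReal Matrix.Norms.L2Operator
open MeasureTheory Set Filter
open Literature.MathematicalPhysics.QuantumFieldTheory Literature.MathematicalPhysics.QuantumLattice
  Literature.Probability.LatticeModels
open Summit.QuantumFields.QCD.Theses.PauliWegnerSea

/-! ## §0  Trunk (verbatim copy of `Lines/R1DensityReduction.lean`, ideator 3 — PROVED there and here) -/

/-- (R1) GLOBAL RELATIVE SMALL BALLS under the untilted product Haar law, uniformly in masses,
volume, outside and sites: `Haar{F ≤ ε F(W₀)} ≤ C ε^c` for every `W₀` with `F(W₀) > 0` (in particular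
the argmax when `F ≢ 0`; if `F ≡ 0` on the fibre then `M = 0`, clause (b′) is guarded and (a) is `0 ≤ 0`).
This is the only genuinely analytic input of the crux (see `CruxOfR1Density`). -/
def HaarRelativeSmallBalls : Prop :=
  ∀ Nf : ℕ, ∃ C c : ℝ, 0 < C ∧ 0 < c ∧ ∀ mq : Fin Nf → ℝ, (∀ f, -2 ≤ mq f ∧ mq f ≤ 2) →
    ∀ (L : ℕ) [NeZero L], 4 ≤ L →
    ∀ (U : GaugeConfig 4 L (Matrix.specialUnitaryGroup (Fin 3) ℂ)) (x y : TorusSite 4 L),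
    let star : Edge 4 L → Prop := fun e => e.1 = x ∨ Site.shift e.1 e.2 = x ∨ e.1 = y ∨ Site.shift e.1 e.2 = y
    let refit : GaugeConfig 4 L (Matrix.specialUnitaryGroup (Fin 3) ℂ) →
        GaugeConfig 4 L (Matrix.specialUnitaryGroup (Fin 3) ℂ) := fun W e => if star e then W e else U e
    let F : GaugeConfig 4 L (Matrix.specialUnitaryGroup (Fin 3) ℂ) → ℝ :=
      fun W => ‖(diracMatrix (refit W) mq).det‖
    let haar : Measure (GaugeConfig 4 L (Matrix.specialUnitaryGroup (Fin 3) ℂ)) :=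
      Measure.pi fun _ => haarProbability (Matrix.specialUnitaryGroup (Fin 3) ℂ)
    ∀ (W₀ : GaugeConfig 4 L (Matrix.specialUnitaryGroup (Fin 3) ℂ)), 0 < F W₀ → ∀ ε : ℝ, 0 < ε →
      (haar {W | F W ≤ ε * F W₀}).toReal ≤ C * ε ^ c

/-- TILT DENSITY BOUND (the Lipschitz/Taylor sandwich; not this card's lever): the star-conditional
Wilson law has density `wt/Z ≤ C (1+β)^p` against product Haar, uniformly in the outside. -/
def TiltDensityBound : Prop :=
  ∃ C p : ℝ, 0 < C ∧ ∀ β : ℝ, 0 ≤ β → ∀ (L : ℕ) [NeZero L], 4 ≤ L →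
    ∀ (U : GaugeConfig 4 L (Matrix.specialUnitaryGroup (Fin 3) ℂ)) (x y : TorusSite 4 L),
    let star : Edge 4 L → Prop := fun e => e.1 = x ∨ Site.shift e.1 e.2 = x ∨ e.1 = y ∨ Site.shift e.1 e.2 = y
    let refit : GaugeConfig 4 L (Matrix.specialUnitaryGroup (Fin 3) ℂ) →
        GaugeConfig 4 L (Matrix.specialUnitaryGroup (Fin 3) ℂ) := fun W e => if star e then W e else U e
    let wt : GaugeConfig 4 L (Matrix.specialUnitaryGroup (Fin 3) ℂ) → ℝ :=
      fun W => Real.exp (-(β * wilsonAction (fundamentalRep (Fin 3)) (refit W)))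
    let haar : Measure (GaugeConfig 4 L (Matrix.specialUnitaryGroup (Fin 3) ℂ)) :=
      Measure.pi fun _ => haarProbability (Matrix.specialUnitaryGroup (Fin 3) ℂ)
    let Z : ℝ := ∫ W, wt W ∂haar
    ∀ W, wt W / Z ≤ C * (1 + β) ^ p

/-- SURJECTIVE INTEGER-SPECTRUM WORD (Givens/Euler for `SU(3)`): finitely many one-parameter
subgroups `t ↦ exp(t Xⱼ)` of `SU(3)` whose matrix entries are trigonometric polynomials of degree
`≤ 2` in `t` (⇔ `spec Xⱼ ⊂ i{−2,…,2}`), such that EVERY `g ∈ SU(3)` is an ordered product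
`exp(θ₁X₁)⋯exp(θ_dX_d)`.  (E.g. `d = 8`: the generalized Euler angles
`e^{iαλ₃}e^{iβλ₂}e^{iγλ₃}e^{iθλ₅}e^{iaλ₃}e^{ibλ₂}e^{icλ₃}e^{iφ√3λ₈}`; or a Givens elimination word.) -/
def SU3SurjectiveWord : Prop :=
  ∃ (d : ℕ) (X : Fin d → Matrix (Fin 3) (Fin 3) ℂ),
    (∀ j, ∀ t : ℝ, NormedSpace.exp ((t : ℂ) • X j) ∈ Matrix.specialUnitaryGroup (Fin 3) ℂ) ∧
    (∀ j, ∃ A : Fin 5 → Matrix (Fin 3) (Fin 3) ℂ, ∀ t : ℝ,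
      NormedSpace.exp ((t : ℂ) • X j) =
        ∑ n : Fin 5, Complex.exp ((((n : ℕ) : ℝ) - 2 : ℝ) * t * Complex.I) • A n) ∧
    ∀ g : Matrix.specialUnitaryGroup (Fin 3) ℂ, ∃ θ : Fin d → ℝ,
      (g : Matrix (Fin 3) (Fin 3) ℂ) = (List.ofFn fun j => NormedSpace.exp ((θ j : ℂ) • X j)).prod

/-- ABSTRACT FORM OF `CruxOfR1Density`, PROVED: on a compact space with a finite measure `μ`, a
continuous amplitude `F ≥ 0`, a continuous positive weight `w` with DENSITY BOUND `w/Z ≤ K`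
(`Z = ∫ w`), and RELATIVE SMALL BALLS `μ{F ≤ ε F(x₀)} ≤ C_R ε^c` for every `x₀` with `F(x₀) > 0`:
(a) `F(x₀) ≤ 2(2KC_R+1)^{1/c} · M` for every `x₀`, `M = ∫Fw/Z` (flatness WITHOUT any local Remez
lemma), and (b) `∫ 1{F ≤ εM} w / Z ≤ K C_R ε^c`.  With `K = C_D(1+β)^{p₀}` this is the crux with
`p = max(p₀/c, p₀)`. -/
theorem flatness_and_smallBalls_of_anticoncentration
    {X : Type*} [TopologicalSpace X] [CompactSpace X] [MeasurableSpace X] [OpensMeasurableSpace X]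
    (μ : Measure X) [IsFiniteMeasure μ] {F w : X → ℝ} (hF : Continuous F) (hw : Continuous w)
    (hF0 : ∀ x, 0 ≤ F x) (hw0 : ∀ x, 0 ≤ w x) {K C_R c : ℝ} (hK : 0 ≤ K) (hCR : 0 ≤ C_R) (hc : 0 < c)
    (hZ : 0 < ∫ y, w y ∂μ) (hdens : ∀ x, w x ≤ K * ∫ y, w y ∂μ)
    (hR1 : ∀ x₀, 0 < F x₀ → ∀ ε : ℝ, 0 < ε → (μ {x | F x ≤ ε * F x₀}).toReal ≤ C_R * ε ^ c) :
    (∀ x₀, F x₀ ≤ 2 * (2 * K * C_R + 1) ^ (1 / c) * ((∫ x, F x * w x ∂μ) / ∫ y, w y ∂μ)) ∧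
    (0 < (∫ x, F x * w x ∂μ) / (∫ y, w y ∂μ) → ∀ ε : ℝ, 0 < ε →
      (∫ x, (if F x ≤ ε * ((∫ x, F x * w x ∂μ) / ∫ y, w y ∂μ) then (1 : ℝ) else 0) * w x ∂μ) /
          (∫ y, w y ∂μ) ≤ K * C_R * ε ^ c) := by
  set Z : ℝ := ∫ y, w y ∂μ with hZdef
  have hwi : Integrable w μ := Summit.QuantumFields.QCD.Theorems.TiltedFlatnessNegative.integrable_of_continuous hw
  have hFwi : Integrable (fun x => F x * w x) μ :=
    Summit.QuantumFields.QCD.Theorems.TiltedFlatnessNegative.integrable_of_continuous (hF.mul hw)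
  -- the weighted mass of a closed sublevel set `{F ≤ t}` is at most `K Z μ{F ≤ t}`
  have hmass : ∀ t : ℝ, ∫ x in {x | F x ≤ t}, w x ∂μ ≤ K * Z * (μ {x | F x ≤ t}).toReal := by
    intro t
    have hmeas : MeasurableSet {x | F x ≤ t} := (isClosed_le hF continuous_const).measurableSet
    calc ∫ x in {x | F x ≤ t}, w x ∂μ ≤ ∫ x in {x | F x ≤ t}, K * Z ∂μ := by
          refine setIntegral_mono_on hwi.integrableOn (integrableOn_const) hmeas fun x _ => ?_
          exact hdens x
      _ = K * Z * (μ {x | F x ≤ t}).toReal := by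
          rw [setIntegral_const, smul_eq_mul, mul_comm]; rfl
  by_cases hX : Nonempty X
  swap
  · haveI : IsEmpty X := not_nonempty_iff.mp hX
    refine ⟨fun x₀ => (IsEmpty.false x₀).elim, fun hM ε hε => ?_⟩
    simp [integral_of_isEmpty] at hM
  obtain ⟨xm, -, hxm⟩ := isCompact_univ.exists_isMaxOn univ_nonempty hF.continuousOn
  have hFmax : ∀ x, F x ≤ F xm := fun x => hxm (mem_univ x)
  -- `M ≤ F xm`
  have hM_le : (∫ x, F x * w x ∂μ) / Z ≤ F xm := by
    rw [div_le_iff₀ hZ]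
    calc ∫ x, F x * w x ∂μ ≤ ∫ x, F xm * w x ∂μ :=
          integral_mono hFwi (hwi.const_mul _) fun x => mul_le_mul_of_nonneg_right (hFmax x) (hw0 x)
      _ = F xm * Z := by rw [integral_const_mul]
  constructor
  · -- (a) flatness
    intro x₀
    set A : ℝ := 2 * K * C_R + 1 with hA
    have hApos : 0 < A := by positivity
    set δ : ℝ := A ^ (-(1 / c)) with hδ
    have hδpos : 0 < δ := Real.rpow_pos_of_pos hApos _
    have hδc : δ ^ c = A⁻¹ := by
      rw [hδ, ← Real.rpow_mul hApos.le, neg_mul, one_div, inv_mul_cancel₀ hc.ne', Real.rpow_neg hApos.le,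
        Real.rpow_one]
    have hinvδ : δ⁻¹ = A ^ (1 / c) := by
      rw [hδ, Real.rpow_neg hApos.le, inv_inv]
    by_cases hFm0 : F xm ≤ 0
    · have h0 : F x₀ = 0 := le_antisymm ((hFmax x₀).trans hFm0) (hF0 x₀)
      rw [h0]
      refine mul_nonneg (by positivity) (div_nonneg (integral_nonneg fun x => ?_) hZ.le)
      exact mul_nonneg (hF0 x) (hw0 x)
    push Not at hFm0
    -- mass of the deep sublevel set `B = {F ≤ δ F xm}` is at most `K Z C_R δ^c ≤ Z/2`
    set B : Set X := {x | F x ≤ δ * F xm} with hB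
    have hBmeas : MeasurableSet B := (isClosed_le hF continuous_const).measurableSet
    have hBmass : ∫ x in B, w x ∂μ ≤ Z / 2 := by
      calc ∫ x in B, w x ∂μ ≤ K * Z * (μ B).toReal := hmass _
        _ ≤ K * Z * (C_R * δ ^ c) := by
            refine mul_le_mul_of_nonneg_left (hR1 xm hFm0 δ hδpos) (by positivity)
        _ = Z * (K * C_R / A) := by rw [hδc]; ring
        _ ≤ Z * (1 / 2) := by
            refine mul_le_mul_of_nonneg_left ?_ hZ.le
            rw [div_le_iff₀ hApos, hA]; nlinarith [mul_nonneg hK hCR]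
        _ = Z / 2 := by ring
    -- lower bound for `∫ F w` on the complement of `B`
    have hlow : δ * F xm * (Z / 2) ≤ ∫ x, F x * w x ∂μ := by
      have hcompl : ∫ x in Bᶜ, w x ∂μ = Z - ∫ x in B, w x ∂μ := setIntegral_compl hBmeas hwi
      have h1 : δ * F xm * (Z / 2) ≤ δ * F xm * ∫ x in Bᶜ, w x ∂μ := by
        refine mul_le_mul_of_nonneg_left ?_ (by positivity)
        rw [hcompl]; linarith
      have h2 : δ * F xm * ∫ x in Bᶜ, w x ∂μ = ∫ x in Bᶜ, δ * F xm * w x ∂μ := by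
        rw [integral_const_mul]
      have h3 : ∫ x in Bᶜ, δ * F xm * w x ∂μ ≤ ∫ x in Bᶜ, F x * w x ∂μ := by
        refine setIntegral_mono_on ((hwi.const_mul _).integrableOn) hFwi.integrableOn hBmeas.compl
          fun x hx => ?_
        have hx' : δ * F xm < F x := by
          simpa [hB] using hx
        exact mul_le_mul_of_nonneg_right hx'.le (hw0 x)
      have h4 : ∫ x in Bᶜ, F x * w x ∂μ ≤ ∫ x, F x * w x ∂μ :=
        setIntegral_le_integral hFwi (Eventually.of_forall fun x => mul_nonneg (hF0 x) (hw0 x))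
      linarith
    -- conclude
    set I : ℝ := ∫ x, F x * w x ∂μ with hI
    have hδne : δ ≠ 0 := hδpos.ne'
    have hZne : Z ≠ 0 := hZ.ne'
    have h1 : F xm * (δ * Z) ≤ I * 2 := by
      have : F xm * (δ * Z) = 2 * (δ * F xm * (Z / 2)) := by ring
      linarith
    have hkey : F xm ≤ 2 * δ⁻¹ * (I / Z) := by
      calc F xm = F xm * (δ * Z) / (δ * Z) := by field_simp
        _ ≤ I * 2 / (δ * Z) := by gcongr
        _ = 2 * δ⁻¹ * (I / Z) := by field_simp
    calc F x₀ ≤ F xm := hFmax x₀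
      _ ≤ 2 * δ⁻¹ * (I / Z) := hkey
      _ = 2 * A ^ (1 / c) * (I / Z) := by rw [hinvδ]
  · -- (b′) relative small balls
    intro hM ε hε
    set M : ℝ := (∫ x, F x * w x ∂μ) / Z with hMdef
    have hFm : 0 < F xm := lt_of_lt_of_le hM hM_le
    have hsub : {x | F x ≤ ε * M} ⊆ {x | F x ≤ ε * F xm} := fun x hx =>
      le_trans (show F x ≤ ε * M from hx) (mul_le_mul_of_nonneg_left hM_le hε.le)
    have hmeas : MeasurableSet {x | F x ≤ ε * M} := (isClosed_le hF continuous_const).measurableSet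
    have hind : ∫ x, (if F x ≤ ε * M then (1 : ℝ) else 0) * w x ∂μ = ∫ x in {x | F x ≤ ε * M}, w x ∂μ := by
      rw [← integral_indicator hmeas]
      congr 1; ext x
      by_cases hx : F x ≤ ε * M
      · simp [hx]
      · simp [hx]
    rw [hind, div_le_iff₀ hZ]
    calc ∫ x in {x | F x ≤ ε * M}, w x ∂μ ≤ K * Z * (μ {x | F x ≤ ε * M}).toReal := hmass _
      _ ≤ K * Z * (μ {x | F x ≤ ε * F xm}).toReal := by
          refine mul_le_mul_of_nonneg_left ?_ (by positivity)
          exact ENNReal.toReal_mono (measure_ne_top _ _) (measure_mono hsub)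
      _ ≤ K * Z * (C_R * ε ^ c) := mul_le_mul_of_nonneg_left (hR1 xm hFm ε hε) (by positivity)
      _ = K * C_R * ε ^ c * Z := by ring

/-- STRUCTURAL REDUCTION (both clauses): (R1) + density bound ⇒ the crux (verbatim the trunk's
`CruxOfR1Density`; stated through this `def` so that the skeleton audit sees exactly ONE kind of
theorem concluding the crux by name — `TiltedFlatness_of` / `TiltedFlatness_of_stubs` of §4). -/
def CruxOfR1Density : Prop := HaarRelativeSmallBalls → TiltDensityBound → TiltedFlatness

/-- PROVED (verbatim the trunk's `tiltedFlatness_of_R1_density`): the crux `TiltedFlatness`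
(item 14070, both clauses) follows from (R1) `HaarRelativeSmallBalls` and the sandwich
`TiltDensityBound`, with `C = max(2(2C_DC_R+1)^{1/c}, C_DC_R)`, `p = max(p₀⁺/c, p₀⁺)`, same `c`. -/
theorem cruxOfR1Density_holds : CruxOfR1Density := by
  intro hR1 hD Nf
  obtain ⟨C_R, c, hCR, hc, hR⟩ := hR1 Nf
  obtain ⟨C_D, p₀, hCD, hDD⟩ := hD
  set P : ℝ := max (max p₀ 0 / c) (max p₀ 0) with hP
  set Cbig : ℝ := max (2 * (2 * C_D * C_R + 1) ^ (1 / c)) (C_D * C_R) with hCbig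
  refine ⟨Cbig, P, c, lt_max_of_lt_right (mul_pos hCD hCR), hc, ?_⟩
  intro β hβ mq hmq L _ hL U x y star refit F wt haar Z M
  -- continuity of the carriers
  have hrefit : Continuous refit := by
    refine continuous_pi fun e => ?_
    by_cases h : star e
    · simp only [refit, if_pos h]; exact continuous_apply e
    · simp only [refit, if_neg h]; exact continuous_const
  have hFc : Continuous F :=
    continuous_norm.comp
      (((Summit.QuantumFields.QCD.Theorems.TiltedFlatnessNegative.continuous_diracMatrix mq).comp
        hrefit).matrix_det)
  have hSc : Continuous fun W => wilsonAction (fundamentalRep (Fin 3)) (refit W) :=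
    (Summit.QuantumFields.QCD.Theorems.TiltedFlatnessNegative.continuous_wilsonAction
      (fundamentalRep (Fin 3)) (continuous_fundamentalRep (Fin 3))).comp hrefit
  have hwtc : Continuous wt := Real.continuous_exp.comp ((continuous_const.mul hSc).neg)
  have hF0 : ∀ W, 0 ≤ F W := fun W => norm_nonneg _
  have hwt0 : ∀ W, 0 < wt W := fun W => Real.exp_pos _
  haveI : IsProbabilityMeasure haar := by
    show IsProbabilityMeasure (Measure.pi fun _ => haarProbability (Matrix.specialUnitaryGroup (Fin 3) ℂ))
    infer_instance
  -- `Z > 0`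
  have hZ : 0 < Z := by
    obtain ⟨Wm, -, hWm⟩ := isCompact_univ.exists_isMinOn univ_nonempty hwtc.continuousOn
    have hle : ∫ W, wt Wm ∂haar ≤ Z :=
      integral_mono (integrable_const _)
        (Summit.QuantumFields.QCD.Theorems.TiltedFlatnessNegative.integrable_of_continuous hwtc)
        fun W => hWm (mem_univ W)
    have hc' : ∫ W, wt Wm ∂haar = wt Wm := by simp
    linarith [hwt0 Wm]
  -- density bound and small balls, read off the hypotheses (the `let`s agree definitionally)
  have h1β : (1 : ℝ) ≤ 1 + β := by linarith
  set t : ℝ := (1 + β) ^ (max p₀ 0) with ht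
  have ht1 : 1 ≤ t := Real.one_le_rpow h1β (le_max_right _ _)
  have hKle : C_D * (1 + β) ^ p₀ ≤ C_D * t :=
    mul_le_mul_of_nonneg_left (Real.rpow_le_rpow_of_exponent_le h1β (le_max_left _ _)) hCD.le
  have hdens : ∀ W, wt W ≤ C_D * t * Z := by
    intro W
    have h := hDD β hβ L hL U x y W
    have h' : wt W / Z ≤ C_D * (1 + β) ^ p₀ := h
    rw [div_le_iff₀ hZ] at h'
    exact h'.trans (mul_le_mul_of_nonneg_right hKle hZ.le)
  have hR1' : ∀ W₀, 0 < F W₀ → ∀ ε : ℝ, 0 < ε → (haar {W | F W ≤ ε * F W₀}).toReal ≤ C_R * ε ^ c :=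
    fun W₀ hW₀ ε hε => hR mq hmq L hL U x y W₀ hW₀ ε hε
  obtain ⟨ha, hb⟩ := flatness_and_smallBalls_of_anticoncentration haar hFc hwtc hF0
    (fun W => (hwt0 W).le) (by positivity : 0 ≤ C_D * t) hCR.le hc hZ hdens hR1'
  -- constants: `(2 C_D t C_R + 1)^{1/c} ≤ (2 C_D C_R + 1)^{1/c} t^{1/c}` and `t^{1/c}, t ≤ (1+β)^P`
  have hA : 2 * (C_D * t) * C_R + 1 ≤ (2 * C_D * C_R + 1) * t := by nlinarith [mul_pos hCD hCR]
  have htP1 : t ^ (1 / c) ≤ (1 + β) ^ P := by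
    rw [ht, ← Real.rpow_mul (by linarith), mul_one_div]
    exact Real.rpow_le_rpow_of_exponent_le h1β (le_max_left _ _)
  have htP2 : t ≤ (1 + β) ^ P := Real.rpow_le_rpow_of_exponent_le h1β (le_max_right _ _)
  have hM0 : 0 ≤ M := div_nonneg (integral_nonneg fun W => mul_nonneg (hF0 W) (hwt0 W).le) hZ.le
  refine ⟨fun W₀ => (ha W₀).trans ?_, fun hM ε hε => (hb hM ε hε).trans ?_⟩
  · have h2 : (2 * (C_D * t) * C_R + 1) ^ (1 / c) ≤ (2 * C_D * C_R + 1) ^ (1 / c) * (1 + β) ^ P := by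
      calc (2 * (C_D * t) * C_R + 1) ^ (1 / c) ≤ ((2 * C_D * C_R + 1) * t) ^ (1 / c) :=
            Real.rpow_le_rpow (by positivity) hA (by positivity)
        _ = (2 * C_D * C_R + 1) ^ (1 / c) * t ^ (1 / c) := Real.mul_rpow (by positivity) (by positivity)
        _ ≤ (2 * C_D * C_R + 1) ^ (1 / c) * (1 + β) ^ P :=
            mul_le_mul_of_nonneg_left htP1 (by positivity)
    calc 2 * (2 * (C_D * t) * C_R + 1) ^ (1 / c) * M
        ≤ 2 * ((2 * C_D * C_R + 1) ^ (1 / c) * (1 + β) ^ P) * M := by gcongr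
      _ = (2 * (2 * C_D * C_R + 1) ^ (1 / c)) * (1 + β) ^ P * M := by ring
      _ ≤ Cbig * (1 + β) ^ P * M := by gcongr; exact le_max_left _ _
  · calc C_D * t * C_R * ε ^ c = (C_D * C_R) * t * ε ^ c := by ring
      _ ≤ Cbig * (1 + β) ^ P * ε ^ c := by
          gcongr
          · exact le_max_right _ _

/-! ## §1  Vocabulary of the flat side -/

/-- Local shorthand for the colour group (the tree's `SU3` abbreviation lives in `QCD.lean`,
outside this file's import closure). -/
local notation "SU(3)" => Matrix.specialUnitaryGroup (Fin 3) ℂ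


/-- TRIGONOMETRIC POLYNOMIAL on the torus `ℝ^ι/2πℤ^ι` of degree `≤ D` in EACH angle:
`Q(t) = Σ_{k ∈ [−D,D]^ι} c_k e^{i k·t}`.  (Closed under products — degrees add — and under
`t ↦ Q(t + t₀)`; `|Q|²` is again one, of degree `≤ 2D`; `2π`-periodic in every angle.) -/
def IsTrigPoly (ι : Type*) [Fintype ι] [DecidableEq ι] (D : ℕ) (Q : (ι → ℝ) → ℂ) : Prop :=
  ∃ c : (ι → ℤ) → ℂ, ∀ t : ι → ℝ,
    Q t = ∑ k ∈ Fintype.piFinset (fun _ : ι => Finset.Icc (-(D : ℤ)) D),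
      c k * Complex.exp ((↑(∑ j, (k j : ℝ) * t j) : ℂ) * Complex.I)

/-- THE TRANSFER `C⁺` (β = 0 part of the card's `TorusTiltedRemez`, split from the tilt as triage
r1-1 asked): RELATIVE SMALL BALLS FOR TRIGONOMETRIC POLYNOMIALS ON THE FLAT TORUS.  For all `m, D`
there are `C, c > 0` such that for every trigonometric polynomial `Q` of degree `≤ D` per angle on
`T^m` and every reference point `t₀` with `Q(t₀) ≠ 0`:
`Leb{t ∈ [0,2π]^m : |Q(t)| ≤ ε |Q(t₀)|} ≤ C ε^c` for all `ε > 0`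
(a fortiori from the sup-relative bound, since `|Q(t₀)| ≤ sup|Q|`). -/
def TorusTrigSmallBalls : Prop :=
  ∀ m D : ℕ, ∃ C c : ℝ, 0 < C ∧ 0 < c ∧
    ∀ Q : (Fin m → ℝ) → ℂ, IsTrigPoly (Fin m) D Q →
    ∀ t₀ : Fin m → ℝ, Q t₀ ≠ 0 → ∀ ε : ℝ, 0 < ε →
      (volume ({t : Fin m → ℝ | ‖Q t‖ ≤ ε * ‖Q t₀‖} ∩ Set.Icc (0 : Fin m → ℝ) (fun _ => 2 * π))).toReal
        ≤ C * ε ^ c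

/-- Variables of a LINK POLYNOMIAL on `SU(3)^n`: the matrix entry `(j, a, b)` (left summand) and
its complex conjugate (right summand). -/
abbrev LinkVar (n : ℕ) : Type := (Fin n × Fin 3 × Fin 3) ⊕ (Fin n × Fin 3 × Fin 3)

/-- Evaluation of a link polynomial at an `n`-tuple of special unitary matrices (entries and
conjugate entries substituted). -/
noncomputable def linkEval {n : ℕ} (P : MvPolynomial (LinkVar n) ℂ) (g : Fin n → SU(3)) : ℂ :=
  MvPolynomial.eval
    (Sum.elim (fun v : Fin n × Fin 3 × Fin 3 => (g v.1 : Matrix (Fin 3) (Fin 3) ℂ) v.2.1 v.2.2)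
      (fun v : Fin n × Fin 3 × Fin 3 => star ((g v.1 : Matrix (Fin 3) (Fin 3) ℂ) v.2.1 v.2.2))) P

/-- HAAR ANTI-CONCENTRATION FOR LINK POLYNOMIALS (the abstract form of (R1)): for all `n, D` there
are `C, c > 0` such that for every polynomial `P` of total degree `≤ D` in the entries of `n`
special unitary matrices and their conjugates, and every `g₀` with `P(g₀) ≠ 0`,
`Haar^{⊗n}{g : |P(g)| ≤ ε |P(g₀)|} ≤ C ε^c` for all `ε > 0`. -/
def HaarPolyAnticoncentration : Prop :=
  ∀ n D : ℕ, ∃ C c : ℝ, 0 < C ∧ 0 < c ∧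
    ∀ P : MvPolynomial (LinkVar n) ℂ, P.totalDegree ≤ D →
    ∀ g₀ : Fin n → SU(3), linkEval P g₀ ≠ 0 → ∀ ε : ℝ, 0 < ε →
      ((Measure.pi fun _ : Fin n => haarProbability SU(3))
          {g : Fin n → SU(3) | ‖linkEval P g‖ ≤ ε * ‖linkEval P g₀‖}).toReal ≤ C * ε ^ c

/-! ## §2  The lever, proved: the word coupling `Haar^{⊗n} = Haar^{⊗n} ∗ Φ_*ν` -/

/-- **WORD COUPLING** (the card's First lemma, re-proved here so that it is importable — triage
r1-1/r1-3 sharpening): for ANY s-finite measure `ν` on a parameter space `T`, ANY measurable map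
`Φ : T → SU(3)^ι` and every measurable `f ≥ 0`,
`ν(T) · ∫ f dHaar^{⊗ι} = ∫ (∫ f(W · Φ t) dν(t)) dHaar^{⊗ι}(W)`
— right invariance of the product Haar probability (`Measure.pi.isMulRightInvariant` over the
tree's `haarProbability.instIsMulRightInvariant`) and Tonelli; NOTHING about `Φ` beyond
measurability is used (surjectivity and closedness of the circles enter only through the stubs).
With `ν` = Lebesgue on `[0,2π]^m` and `Φ` the Euler word this is `Haar = Haar ∗ Φ_*Leb/(2π)^m`. -/
theorem wordCoupling {ι : Type*} [Fintype ι] {T : Type*} [MeasurableSpace T] (ν : Measure T)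
    [SFinite ν] (Φ : T → (ι → SU(3))) (hΦ : Measurable Φ) (f : (ι → SU(3)) → ℝ≥0∞)
    (hf : Measurable f) :
    ν univ * ∫⁻ W, f W ∂(Measure.pi fun _ : ι => haarProbability SU(3)) =
      ∫⁻ W, ∫⁻ t, f (W * Φ t) ∂ν ∂(Measure.pi fun _ : ι => haarProbability SU(3)) := by
  set μ : Measure (ι → SU(3)) := Measure.pi fun _ : ι => haarProbability SU(3) with hμ
  have hmeas : Measurable (Function.uncurry fun (W : ι → SU(3)) (t : T) => f (W * Φ t)) :=
    hf.comp (measurable_fst.mul (hΦ.comp measurable_snd))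
  calc ν univ * ∫⁻ W, f W ∂μ = ∫⁻ _t, ∫⁻ W, f W ∂μ ∂ν := by rw [lintegral_const, mul_comm]
    _ = ∫⁻ t, ∫⁻ W, f (W * Φ t) ∂μ ∂ν := by
        refine lintegral_congr fun t => ?_
        exact (lintegral_mul_right_eq_self f (Φ t)).symm
    _ = ∫⁻ W, ∫⁻ t, f (W * Φ t) ∂ν ∂μ := (lintegral_lintegral_swap hmeas.aemeasurable).symm

/-! ## §3  The five registered stubs

`theorem stub_<name> : <signature> := by sorry`, signatures over the vocabulary of §0–§1.  The
composition `TiltedFlatness_of` (§4) takes the five signatures as hypotheses BY NAME through the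
name-keyed aliases `__Sig.stub_<name>` (skeleton audit: a hypothesis is admissible iff its head is a
registered obligation / declared stub by name; `@[stub]` tags are gate-stamped, not written here; the
`__` namespace is an implementation detail invisible to the audit's stub report — device of
`SmoothPoincare4/…/Lines/lp-by-minimal-heegaard-splitting.lean`). -/

/-- **stub_eulerWord** (size M; shared verbatim with line torus-word-abelianisation — its
statement is the trunk decl `SU3SurjectiveWord` of §0, byte-identical to
`R1DensityReduction.SU3SurjectiveWord`).  A SURJECTIVE WORD IN CLOSED CIRCLE SUBGROUPS WITH ITS
DEGREE EXPORTED (triage r1-2 N1): finitely many `X_j ∈ 𝔰𝔲(3)` such that each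
`t ↦ exp(tX_j)` lies in `SU(3)` and has entries `Σ_{|n|≤2} e^{int} A_n` (⇔ `spec X_j ⊂ i{−2,…,2}`;
hence `2π`-periodic), and EVERY `g ∈ SU(3)` is an ordered product `exp(θ₁X₁)⋯exp(θ_dX_d)`.
Witness: the Givens word of `d = 8`–`10` factors in the generators `i(E₁₁−E₂₂)`, `E₁₂−E₂₁`,
`i(E₂₂−E₃₃)`, `E₂₃−E₃₂` (spectrum `{±i, 0}`: `X³ = −X`, `exp(tX) = 1 + sin t·X + (1−cos t)·X²`,
degree 1) — `SU(3) = SU(2)₁₂·SU(2)₂₃·SU(2)₁₂` with ZYZ inside the blocks (kit j008681 part A: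
complex Givens elimination, residual ≤ 1e−12 on 300 Haar samples); or Byrd's generalized Euler
angles (physics/9708015; degree 2 only through `e^{iφ√3λ₈}`).  Why plausibly true: textbook
(`KAK`, Knapp Thm 7.39; Golub–Van Loan §5.1).  Leans on: Mathlib `NormedSpace.exp`,
`Matrix.specialUnitaryGroup`, `Matrix.exp_diagonal`/power series of a matrix with `X³ = −X`. -/
theorem stub_eulerWord : SU3SurjectiveWord := by
  sorry

/-- **stub_torusSmallBalls** (size L; THE ENGINE, hardest; = the Transfer `C⁺`).  Relative small
balls for trigonometric polynomials of degree `≤ D` per angle on the flat torus `T^m`, constants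
depending on `(m, D)` only.  Why plausibly true / proof routes, all over PROVED tree inputs:
(i) half-angle charts `t_j = πσ_j + 2 arctan u_j`, `u ∈ [−1,1]^m` (Jacobian `∏ 2/(1+u_j²) ∈ [1,2]^m`):
on each of the `2^m` charts `Q = R_σ(u)/∏(1+u_j²)^D` with `|R_σ|²` a REAL polynomial of total degree
`≤ 4Dm` on the convex body `[−1,1]^m`, every chart carries `sup|R_σ|² ≥ (4e)^{−2(2D+1)m} sup|Q|²`
(one-variable Remez `CarberyWright.remez_weak` walked one coordinate at a time through the even/odd
split `q = P(cos θ) + sin θ·U(cos θ)`), and `CarberyWright.supSublevelBound_holds` (CW 2001 Thm 2,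
q = ∞, absolute constant `16e²`, PROVED at `CarberyWrightProofs.lean`) bounds each chart's sublevel
volume by `C m ε^{1/(2Dm)}`; (ii) induction-free variant: Kronecker winding `t = u + θ(1, N, …, N^{m−1})`,
`N = 2D+1`, makes `θ ↦ Q` a one-variable trigonometric polynomial of degree `< N^m` whose sup is
`≥ max|c_k| ≥ |Q(t₀)|/(2D+1)^m` for EVERY `u`, then 1-D Remez/Turán per fibre and Fubini;
(iii) FTA + Hölder negative moments (`R1DensityReduction.NegMomentCircle/Torus`, ideator 3) give the
same conclusion with `c < 1/(2D)`.  Corners: `D = 0` (constants, `C ≥ (2π)^m`), `m = 0` (point),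
`ε ≥ 1` (need `C ≥ (2π)^m`) — all inside `∃ C`.  Sources: CarberyWright2001 (doi:10.4310/mrl.2001.v8.n3.a1),
Borwein–Erdélyi GTM 161 Thm 5.1.1/5.1.2 (Remez, trigonometric Remez), §6.1 E.6 (Turán on arcs),
Brudnyi–Ganzburg 1973 (doi:10.1070/im1973v007n02abeh001941), Nazarov 1993 (`TuranNazarov.lemma`,
vendored UNPROVED — not needed).  Leans on: `Literature.Analysis.Approximation.CarberyWright.*`
(`supSublevelBound_holds`, `supLeGeometricMean_holds`, `remez_weak`), `MarkovInequality`
(`bernstein_inequality`, `markov_inequality_Icc`), Mathlib `Polynomial.Chebyshev`, `Real.arctan`,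
`MeasureTheory.Measure.pi` / `volume_pi`. -/
theorem stub_torusSmallBalls : TorusTrigSmallBalls := by
  sorry

/-- **stub_wordPullback** (size M; the lever at work).  Surjective closed-circle word + flat small
balls ⇒ Haar anti-concentration for link polynomials.  Proof: fix `n, D`; let `d, X` be the word,
`m = n·d`, `Φ(t)_j = ∏_k exp(t_{j,k} X_k)`.  (1) For `P` of total degree `≤ D`, every fibre map
`Q_g : t ↦ linkEval P (g·Φ(t))` is `IsTrigPoly (Fin n × Fin d) (2D)` (entries of `exp(tX_k)` have
degree `≤ 2` in their own angle and the product word has degree `≤ 2` in EACH angle; conjugation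
flips frequencies; a monomial of degree `≤ D` multiplies `≤ D` such factors), transported to
`Fin m` by `finProdFinEquiv`.  (2) ONTO: for every `g` there is `t_g` with `g·Φ(t_g) = g₀`, so the
reference value `|P(g₀)| = |Q_g(t_g)|` is a value of `Q_g` (periodicity puts `t_g` anywhere).
(3) `wordCoupling` (PROVED above) with `ν = Leb|[0,2π]^m` and `f = 1{|P| ≤ ε|P(g₀)|}`:
`Haar^{⊗n}{|P| ≤ ε|P(g₀)|} = (2π)^{−m} ∫ Leb{t ∈ [0,2π]^m : |Q_g(t)| ≤ ε|Q_g(t_g)|} dHaar(g) ≤ C ε^c`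
by `stub_torusSmallBalls` on every fibre.  Measurability: `P ∘ entries` and `Φ` are continuous.
Why it might fail: only through a typing slip (it is right-invariance + Tonelli + degree count);
the single load-bearing bit is SURJECTIVITY of the word (fibre sees the reference point).
Leans on: `wordCoupling`, `SU3SurjectiveWord`, `IsTrigPoly`, Mathlib `MvPolynomial.eval` API,
`Measure.pi`, `measurableSet_le`, `Real.volume_Icc_pi`. -/
theorem stub_wordPullback :
    SU3SurjectiveWord → TorusTrigSmallBalls → HaarPolyAnticoncentration := by
  sorry

/-- **stub_seaPolynomial** (size M; the band limit that is the route's thesis, in the crude form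
that suffices).  Haar anti-concentration for link polynomials ⇒ (R1) `HaarRelativeSmallBalls`.
Proof: for fixed `N_f` and every `mq, L ≥ 4, U, x, y` enumerate the star
`{e | e.1 ∈ {x,y} ∨ shift e.1 e.2 ∈ {x,y}}` by an injection `ι : Fin n ↪ Edge 4 L`, `n ≤ 16`; then
`W ↦ det (diracMatrix (refit W) mq)` equals `linkEval P (W ∘ ι)` for a link polynomial `P` of total
degree `≤ D(N_f) := 216·N_f` INDEPENDENT of `L, U, mq, x, y`: the entries of `diracMatrix (refit W) mq`
(tree `wilsonDirac`, `r = 1`: `(m+4)δ − ½Σ_μ[(1−γ_μ)⊗ρ(V(p.1,μ))δ + (1+γ_μ)⊗ρ(V(q.1,μ)⁻¹)δ]`,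
`ρ(V⁻¹) = V^†` entrywise conjugate) are AFFINE in the variables, only the `≤ 18·3·4·N_f` rows at
sites of `star ∪ ∂star` carry variables, and `det` is row-multilinear (Leibniz / Laplace along those
rows); the outside `U` and the masses enter the coefficients only (Disproof §7.3: the mass box is not
load-bearing).  The product Haar over ALL edges pushes forward under `W ↦ W ∘ ι` to `Haar^{⊗n}`
(`Measure.pi` marginal, `MeasurePreserving` of coordinate restriction), and
`{F ≤ εF(W₀)} = (∘ι)⁻¹{|P| ≤ ε|P(W₀∘ι)|}`; constants `C = max_{n≤16} C(n,D)`, `c = min_{n≤16} c(n,D)`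
(for `ε ≥ 1` use `Haar ≤ 1 ≤ C`).  (Pauli's sharper bidegree `(6N_f,6N_f)` per link —
support item `PauliBandLimit`, rank count `≤ 4N_f` per Givens angle, kit j008681/j009683/j010040 —
is NOT needed: any `L`-free degree serves.)  Why it might fail: only if the degree secretly grew
with `L` (it does not: locality of `wilsonDirac`) — this is exactly the route's band-limit thesis in
its weakest form.  Leans on: tree `diracMatrix`, `wilsonDirac`, `fundamentalRep`,
`Matrix.det_apply`/`Matrix.det` multilinearity (`MultilinearMap`), `Matrix.reindex`, Mathlib
`MvPolynomial` (`totalDegree_mul/add/…`), `MeasureTheory.measurePreserving_eval`-type marginals of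
`Measure.pi`. -/
theorem stub_seaPolynomial : HaarPolyAnticoncentration → HaarRelativeSmallBalls := by
  sorry

/-- **stub_cubeUntilt** (size M; the tilt, paid once and ball-free — circle-transport §5 /
ideator 2, endorsed by all three triagers as the shared `stub_density`).  Surjective closed-circle
word ⇒ `TiltDensityBound` with `p = m := n·d ≤ 16d` (`n` star links, `d` letters) and
`C = e·(1 + 2πKm)^m`, `K = 18·max_k ‖X_k‖` a per-angle Lipschitz constant of the star action along
the word.  Proof: `S_U(W) := wilsonAction (refit W)` depends on the star links only, is continuous
on the compact fibre, `S_min` is attained; `wt ≤ e^{−βS_min}`.  Lower bound for `Z` (β > 0; at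
`β = 0`, `wt ≡ 1 = Z`): `Z ≥ e^{−βS_min−1}·Haar{S_U ≤ S_min + 1/β}` and, by `wordCoupling` applied to
the indicator with `Φ(t)_e = ∏_k exp(t_{e,k}X_k)` on star edges, `Φ(t)_e = 1` off the star,
`Haar{S_U ≤ S_min + 1/β} = (2π)^{−m}∫ Leb{t ∈ [0,2π]^m : S_U(g·Φ(t)) ≤ S_min + 1/β} dHaar(g)`; on EVERY
fibre the minimum of `t ↦ S_U(g·Φ(t))` is the global `S_min` (the word is ONTO link by link and
`S_U ∘ refit` ignores off-star links; periodicity puts a minimiser `t*(g)` in `[0,2π]^m`), and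
`t ↦ S_U(g·Φ(t))` is `K`-Lipschitz in each angle uniformly in `g, U, L, β` (a link lies in
`2(4−1) = 6` plaquettes; `|∂_t Re tr(A·exp(tX_k)·B)| ≤ 3‖X_k‖` for `A, B` products of unitaries —
outside links enter as FIXED unitary factors, which is why the bound is outside-uniform), so the
fibre sublevel set contains `∏_{(e,k)} ([t*_{ek} − r, t*_{ek} + r] ∩ [0,2π])`, `r = 1/(βKm)`, each
factor of length `≥ min(r, 2π)`; hence `Z ≥ e^{−βS_min−1}(min(r,2π)/2π)^m` and
`wt/Z ≤ e·max(1, 2πβKm)^m ≤ e(1+2πKm)^m (1+β)^m`.  No Haar-ball volume of `SU(3)` is used (the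
tree's `UnitaryHaarSmallBall` is `U(N)`-only — triage r1-3 sharpening (2)).  Why it might fail: it
cannot mathematically (elementary); Lean risks are the boundary box and the `Measure.pi`
bookkeeping of "angles on star edges only" (`m` must not grow with `L`).  Consistent with Disproof
§8 (P1) (`p = 8n` there via balls; here `p = m`).  Leans on: `wordCoupling`, `SU3SurjectiveWord`,
tree `wilsonAction`, `plaquetteHolonomy`, `TiltedFlatnessNegative.continuous_wilsonAction`,
`integrable_of_continuous`, Mathlib `IsCompact.exists_isMinOn`, `Real.volume_Icc_pi`,
`Matrix.trace`/operator-norm bounds for unitaries, `Real.rpow_natCast`. -/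
theorem stub_cubeUntilt : SU3SurjectiveWord → TiltDensityBound := by
  sorry

/-! ## §4  Composition: the five stubs imply the crux, by name -/

namespace __Sig

/-- Alias of the statement of `stub_eulerWord` (keyed by the stub's short name). -/
abbrev stub_eulerWord : Prop := SU3SurjectiveWord
/-- Alias of the statement of `stub_torusSmallBalls`. -/
abbrev stub_torusSmallBalls : Prop := TorusTrigSmallBalls
/-- Alias of the statement of `stub_wordPullback`. -/
abbrev stub_wordPullback : Prop := SU3SurjectiveWord → TorusTrigSmallBalls → HaarPolyAnticoncentration
/-- Alias of the statement of `stub_seaPolynomial`. -/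
abbrev stub_seaPolynomial : Prop := HaarPolyAnticoncentration → HaarRelativeSmallBalls
/-- Alias of the statement of `stub_cubeUntilt`. -/
abbrev stub_cubeUntilt : Prop := SU3SurjectiveWord → TiltDensityBound

end __Sig

/-- **The line closes the crux.**  The statements of `stub_eulerWord`, `stub_torusSmallBalls`,
`stub_wordPullback`, `stub_seaPolynomial`, `stub_cubeUntilt` (as the name-keyed aliases
`__Sig.stub_…`, definitionally the displayed signatures) ⇒ `PauliWegnerSea.TiltedFlatness` — through
the kernel-checked trunk `cruxOfR1Density_holds` (both clauses: (a) from (R1) + density by the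
Chebyshev/mediant argument, (b′) by `{F ≤ εM} ⊆ {F ≤ ε sup F}`; constants
`C = max(2(2C_DC_R+1)^{1/c}, C_DC_R)`, `p = max(m/c, m)`).  Sorry-free, standard axioms. -/
theorem TiltedFlatness_of (h₁ : __Sig.stub_eulerWord) (h₂ : __Sig.stub_torusSmallBalls)
    (h₃ : __Sig.stub_wordPullback) (h₄ : __Sig.stub_seaPolynomial) (h₅ : __Sig.stub_cubeUntilt) :
    Summit.QuantumFields.QCD.Theses.PauliWegnerSea.TiltedFlatness :=
  cruxOfR1Density_holds (h₄ (h₃ h₁ h₂)) (h₅ h₁)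

/-- The composition applied to the five `stub_…` literally (checks that statements, aliases and stubs
agree; `#print axioms` lists exactly the five `sorry`s of the line and nothing else). -/
theorem TiltedFlatness_of_stubs : Summit.QuantumFields.QCD.Theses.PauliWegnerSea.TiltedFlatness :=
  TiltedFlatness_of stub_eulerWord stub_torusSmallBalls stub_wordPullback stub_seaPolynomial
    stub_cubeUntilt

end Summit.QuantumFields.QCD.Cruxes.TiltedFlatness.EulerTorusCover
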